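import Summits.KontsevichZagierPeriods.Zeta5Search.Barrier.ConeGammaTranslateGeneric
import Summits.KontsevichZagierPeriods.Zeta5Search.Barrier.ConeGammaCuspPeriodCanonical

/-!
# ζ(5) search — BARRIER: THE JUMPS OF A COHERENT TRANSLATE ARE THE CANONICAL MARGINALS OF THE JUNCTIONS — the crossings of
# the translated orbit cluster at the junctions of the closed orbit, in the order of the rates (file (1) of «THE CLOSED-ORBIT LIMIT»)

HONEST FRAMING (cell `pub-zeta5`): systematic search; no irrationality claim unless kernel-certified. MODEL objects
under Brown–Zudilin's (28)+(30) accounting ([BZ22] = arXiv:2210.03391; (28) observed, not proved); nothing here is a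
statement about `ζ(5)`, any `γ` of record, the cone's supremum (C2 OPEN) or the value / sign of any jump, pattern function,
chamber weight or cusp slope at a named direction (DATA of the cell); NO cancellation is quantified; S-E / (TD_A) stay
CONJECTURED; records in print UNMOVED. Prover P2 g41 (item «THE CLOSED-ORBIT LIMIT» = P2 g40's successor menu (b), file (1) of
the item; plan INBOX 2026-08-28). Sources: P2 g40 `ConeGammaTranslateGradient` (the per-period signed jump masses
`J_k(δ) = Σ_{z∈S_k} J_{k,z}`, `J_{k,z} = 𝒩(θ_{s_{k,z}}) − 𝒩(θ_{s_{k,z} − r/2})`, are the gradient of the translate integral `P` at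
every translate with a margin `r`), P2 g33 `ConeGammaCuspFloorPattern` / `ConeGammaCuspPeriodCanonical` (the canonical junction
pattern function `patternN a b A` and the period pattern function `F(A) = Σ_{m<#bkpts−1} patternN a b_m A`, whose marginals
`W_k(δ₀) = F(P≤(k)) − F(P<(k))` are the chamber weights of the cusp slope).

SETTING. `a` with all 28 forms positive, `T > 0` a period (`T·h_k(a) = N_k ∈ ℤ`), a translate `δ` with rates
`ρ_k = φ_k(δ)/h_k(a)`, a margin `r > 0` (`hsep`, `hend`, certificate-style) and COHERENCE: `|ρ_k| ≤ ρ̄` with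
`(2ρ̄ + r/2)·x_max(a) < min(1, wallDist a T)`. The translated orbit `θ_u = u·s(a) + δ` crosses the integer `z` of the form `k`
at `s_{k,z} = b − ρ_k`, `b = z/h_k(a)` a junction of the CLOSED orbit, and near `b` the members of `b` cross in the order of
their rates (larger rate first).
* `rate_sep_of_margin`, `rate_ne_of_margin`, `rate_abs_of_margin` — at the lattice junction `b = 0` all 28 forms are members,
  so the margin separates the rates: `r ≤ |ρ_k − ρ_l|` (`k ≠ l`), `r ≤ |ρ_k|` — a translate with a margin is a GENERIC
  reference in P2 g33's sense;
* `floorTerm_add`, `floorTerm_floor_eq_zero_of_int`, `floorN_add_floor_of_int`, **`patternN_add_period`** — the canonical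
  junction pattern function is `T`-PERIODIC in the height (an integer form vector contributes nothing to any floor term,
  `Σ_{i∈F} h_i` being `S₇`-invariant): the junction `T` reads like the lattice junction `0`;
* **`torusN_at_crossing_eq_patternN`** — `𝒩(θ_{s_{k,z}}) = patternN a b {l : ρ_k ≤ ρ_l}` (P2 g33's `torusN_bkpt_add_eq_patternN`
  at the displacement `δ − ρ_k·s(a)`, whose 28 forms are `h_l(a)·(ρ_l − ρ_k)`); **`torusN_before_crossing_eq_patternN`** —
  `𝒩(θ_{s_{k,z} − r/2}) = patternN a b {l : ρ_k < ρ_l}` (on the members `l` of `b` the margin turns `ρ_k + r/2 ≤ ρ_l` into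
  `ρ_k < ρ_l`; non-members do not matter, `patternN_congr`); **`jump_eq_patternN_marginal`: the jump `J_{k,z}` IS the canonical
  marginal `patternN a b (P≤(k)) − patternN a b (P<(k))` of its junction** — the same marginal whose sum over the junctions of
  the period is P2 g33's chamber weight `W_k`;
* bookkeeping for the sum over one period: `sum_range_bkpt_eq_sum_filter_member` (junction sums with vanishing non-member
  terms), `image_member_junctions_eq` / `sum_member_junctions_eq_sum_Ico` (the member junctions of `k` in `[0,T)` are the
  `z/h_k`, `0 ≤ z < N_k`; cf. P2 g30's `card_member_junctions`), `sum_Ioc_floor_eq_sum_Ico` (the crossing window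
  `(⌊φ_kδ⌋, ⌊φ_kδ⌋ + N_k]` of P2 g40 against `[0, N_k)`, by periodicity).
File (2) `ConeGammaTranslateChamberWeights` sums up: `J_k(δ) = W_k(δ)` termwise, the derivative of `P` is the chamber functional,
the cusp slope is `P`'s derivative along the chamber. NOT here (honest): any value of a jump or pattern at a named direction
(DATA); a margin for a given `δ`; `Φ`, `γ`, C2, S-E's truth, `ζ(5)`.
-/

noncomputable section

open Set MeasureTheory Finset
open scoped Topology

namespace Summit.KontsevichZagierPeriods.Zeta5Search.Barrier.ConeGamma

/-! ### The margin separates the rates -/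

/-- **The margin separates the rates**: at the lattice junction `b = 0` every form is a member, so `hsep` with `z = z' = 0`
gives `r ≤ |ρ_k − ρ_l|` for `k ≠ l`. -/
theorem rate_sep_of_margin {a : Dir} {δ : Fin 8 → ℝ} {r : ℝ}
    (hsep : ∀ (k k' : Fin 28) (z z' : ℤ), (k ≠ k' ∨ z ≠ z') →
      r ≤ |((z : ℝ) - phiForm δ k) / h28 a k - ((z' : ℝ) - phiForm δ k') / h28 a k'|)
    {k l : Fin 28} (hkl : k ≠ l) : r ≤ |phiForm δ k / h28 a k - phiForm δ l / h28 a l| := by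
  have h := hsep k l 0 0 (Or.inl hkl)
  rw [Int.cast_zero, zero_sub, zero_sub, neg_div, neg_div, neg_sub_neg, abs_sub_comm] at h
  exact h

/-- With a positive margin the 28 rates are pairwise distinct (a GENERIC reference in the sense of P2 g33). -/
theorem rate_ne_of_margin {a : Dir} {δ : Fin 8 → ℝ} {r : ℝ} (hr : 0 < r)
    (hsep : ∀ (k k' : Fin 28) (z z' : ℤ), (k ≠ k' ∨ z ≠ z') →
      r ≤ |((z : ℝ) - phiForm δ k) / h28 a k - ((z' : ℝ) - phiForm δ k') / h28 a k'|)
    (k l : Fin 28) (hkl : k ≠ l) : phiForm δ k / h28 a k ≠ phiForm δ l / h28 a l := by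
  intro h
  have h' := rate_sep_of_margin hsep hkl
  rw [h, sub_self, abs_zero] at h'
  exact absurd h' (not_le.mpr hr)

/-- **The margin bounds the rates away from `0`**: `hend` with `z = 0` gives `r ≤ |ρ_k|`. -/
theorem rate_abs_of_margin {a : Dir} {δ : Fin 8 → ℝ} {r : ℝ}
    (hend : ∀ (k : Fin 28) (z : ℤ), r ≤ |((z : ℝ) - phiForm δ k) / h28 a k|) (k : Fin 28) :
    r ≤ |phiForm δ k / h28 a k| := by
  have h := hend k 0
  rw [Int.cast_zero, zero_sub, neg_div, abs_neg] at h
  exact h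

/-! ### The canonical junction pattern function is periodic in the height -/

/-- `pairVal` is additive in the vector. -/
theorem pairVal_add (N N' : Fin 28 → ℤ) (i j : Fin 8) :
    pairVal (N + N') i j = pairVal N i j + pairVal N' i j := by
  unfold pairVal
  split_ifs <;> rfl

/-- The floor term is additive in the floor vector. -/
theorem floorTerm_add (N N' : Fin 28 → ℤ) (σ : Equiv.Perm (Fin 7)) :
    floorTerm (N + N') σ = floorTerm N σ + floorTerm N' σ := by
  unfold floorTerm
  rw [← Finset.sum_add_distrib]
  refine Finset.sum_congr rfl fun i _ => ?_
  rw [Pi.add_apply, pairVal_add]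
  ring

/-- All forms of `0` vanish. -/
theorem phiForm_zero (k : Fin 28) : phiForm (0 : Fin 8 → ℝ) k = 0 := by
  have h := phiForm_smul (0 : ℝ) (0 : Fin 8 → ℝ) k
  rwa [zero_smul, zero_mul] at h

/-- **An INTEGER form vector contributes nothing**: if all 28 forms of `ζ` are integers then `floorTerm (⌊φ_k ζ⌋)_k σ = 0`
for every `σ` (the torus term of `ζ` equals that of `0`, `torusTerm_add_of_pairInt`). -/
theorem floorTerm_floor_eq_zero_of_int {ζ : Fin 8 → ℝ} (hζ : ∀ k, ∃ z : ℤ, phiForm ζ k = z)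
    (σ : Equiv.Perm (Fin 7)) : floorTerm (fun k => ⌊phiForm ζ k⌋) σ = 0 := by
  rw [← torusTerm_eq_floorTerm]
  have h := torusTerm_add_of_pairInt (θ := 0) (pairInt_of_phiForm_int hζ) σ
  rw [zero_add] at h
  rw [h, torusTerm_eq_floorTerm]
  have e : (fun k => ⌊phiForm (0 : Fin 8 → ℝ) k⌋) = (0 : Fin 28 → ℤ) := by
    funext k; rw [phiForm_zero, Int.floor_zero]; rfl
  rw [e]
  have h1 := floorTerm_add 0 0 σ
  rw [add_zero] at h1
  linarith

/-- Adding an integer form vector to a floor vector does not change the floor value. -/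
theorem floorN_add_floor_of_int (N : Fin 28 → ℤ) {ζ : Fin 8 → ℝ} (hζ : ∀ k, ∃ z : ℤ, phiForm ζ k = z) :
    floorN (N + fun k => ⌊phiForm ζ k⌋) = floorN N := by
  unfold floorN
  congr 1
  ext σ
  rw [floorTerm_add, floorTerm_floor_eq_zero_of_int hζ, add_zero]

open scoped Classical in
/-- **`patternN` IS `T`-PERIODIC IN THE HEIGHT**: if `T·h_k(a) ∈ ℤ` for every form then
`patternN a (b + T) A = patternN a b A` (the floor vector shifts by the integer vector `(T·h_k(a))_k`, the member set is
unchanged). In particular the junction `T` of the period reads like the lattice junction `0`. -/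
theorem patternN_add_period (a : Dir) {T : ℝ} (hper : ∀ k : Fin 28, ∃ z : ℤ, T * h28 a k = z) (b : ℝ)
    (A : Finset (Fin 28)) : patternN a (b + T) A = patternN a b A := by
  have hζ : ∀ k, ∃ z : ℤ, phiForm (T • sParam a) k = z := fun k => by rw [phiForm_smul_sParam]; exact hper k
  unfold patternN
  have e : (fun k => ⌊(b + T) * h28 a k⌋ - if (∃ z : ℤ, (b + T) * h28 a k = z) ∧ k ∉ A then 1 else 0) =
      (fun k => ⌊b * h28 a k⌋ - if (∃ z : ℤ, b * h28 a k = z) ∧ k ∉ A then 1 else 0) +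
        fun k => ⌊phiForm (T • sParam a) k⌋ := by
    funext k
    obtain ⟨N, hN⟩ := hper k
    have hNf : ⌊phiForm (T • sParam a) k⌋ = N := by rw [phiForm_smul_sParam, hN, Int.floor_intCast]
    have e1 : ⌊(b + T) * h28 a k⌋ = ⌊b * h28 a k⌋ + N := by
      rw [add_mul, hN, Int.floor_add_intCast]
    have e2 : (∃ z : ℤ, (b + T) * h28 a k = z) ↔ ∃ z : ℤ, b * h28 a k = z := by
      rw [add_mul, hN]
      constructor
      · rintro ⟨z, hz⟩; exact ⟨z - N, by push_cast; linarith⟩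
      · rintro ⟨z, hz⟩; exact ⟨z + N, by push_cast; linarith⟩
    simp only [Pi.add_apply, e1, e2, hNf]
    ring
  rw [e, floorN_add_floor_of_int _ hζ]

/-! ### One crossing of the coherent translate: the jump is the canonical marginal of its junction -/

/-- **AT THE CROSSING, THE SAVING IS THE PATTERN OF THE WEAK UPPER RATE SET.** All forms positive; coherence
`|ρ_l| ≤ ρ̄`, `2ρ̄·x_max < min(1, wallDist a T)`; `0 ≤ z`, `z/h_k ≤ T`. Then at the crossing time `s_{k,z} = z/h_k − ρ_k`:
`𝒩(θ_{s_{k,z}}) = patternN a (z/h_k) {l : ρ_k ≤ ρ_l}` (the forms with larger rate have crossed, `k` is crossing). -/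
theorem torusN_at_crossing_eq_patternN {a : Dir} (hpos : ∀ k, 0 < h28 a k) {T : ℝ} {δ : Fin 8 → ℝ} {ρb : ℝ}
    (hρ : ∀ k, |phiForm δ k / h28 a k| ≤ ρb) (hc1 : 2 * ρb * xMax a < 1) (hc2 : 2 * ρb * xMax a < wallDist a T)
    (k : Fin 28) {z : ℤ} (hz0 : 0 ≤ z) (hzT : (z : ℝ) / h28 a k ≤ T) :
    torusN ((((z : ℝ) - phiForm δ k) / h28 a k) • sParam a + δ) =
      patternN a ((z : ℝ) / h28 a k)
        (Finset.univ.filter fun l => phiForm δ k / h28 a k ≤ phiForm δ l / h28 a l) := by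
  classical
  have hb : (z : ℝ) / h28 a k ∈ bkpts a T := div_mem_bkpts (hpos k) hz0 hzT
  have e : (((z : ℝ) - phiForm δ k) / h28 a k) • sParam a + δ =
      ((z : ℝ) / h28 a k) • sParam a + ((-(phiForm δ k / h28 a k)) • sParam a + δ) := by
    rw [sub_div, sub_smul, neg_smul]; abel
  have hφ : ∀ l, phiForm ((-(phiForm δ k / h28 a k)) • sParam a + δ) l =
      h28 a l * (phiForm δ l / h28 a l - phiForm δ k / h28 a k) := fun l => by
    rw [phiForm_line]; field_simp [(hpos l).ne']; ring
  have hbd : ∀ l, |phiForm ((-(phiForm δ k / h28 a k)) • sParam a + δ) l| ≤ 2 * ρb * xMax a := fun l => by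
    rw [hφ l, abs_mul, abs_of_pos (hpos l)]
    have h1 := abs_sub (phiForm δ l / h28 a l) (phiForm δ k / h28 a k)
    have h2 := hρ l
    have h3 := hρ k
    have h4 := le_xMax a l
    have h5 : |phiForm δ l / h28 a l - phiForm δ k / h28 a k| ≤ 2 * ρb := by linarith
    calc h28 a l * |phiForm δ l / h28 a l - phiForm δ k / h28 a k| ≤ xMax a * (2 * ρb) :=
          mul_le_mul h4 h5 (abs_nonneg _) ((hpos l).le.trans h4)
      _ = 2 * ρb * xMax a := by ring
  rw [e, torusN_bkpt_add_eq_patternN hb (fun l => (hbd l).trans_lt hc1) (fun l => (hbd l).trans_lt hc2)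
    (M := Finset.univ) (fun l _ => Finset.mem_univ l)]
  congr 1
  refine Finset.filter_congr fun l _ => ?_
  rw [hφ l, mul_nonneg_iff_of_pos_left (hpos l), sub_nonneg]

/-- **JUST BEFORE THE CROSSING, THE SAVING IS THE PATTERN OF THE STRICT UPPER RATE SET.** With, in addition, a margin `r`
(`hsep`) and coherence `(2ρ̄ + r/2)·x_max < min(1, wallDist a T)`: at the time `s_{k,z} − r/2`,
`𝒩(θ_{s_{k,z} − r/2}) = patternN a (z/h_k) {l : ρ_k < ρ_l}` (on the members `l` of the junction the margin gives
`ρ_k + r/2 ≤ ρ_l ↔ ρ_k < ρ_l`; non-members do not matter, `patternN_congr`). -/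
theorem torusN_before_crossing_eq_patternN {a : Dir} (hpos : ∀ k, 0 < h28 a k) {T : ℝ} {δ : Fin 8 → ℝ} {r : ℝ}
    (hr : 0 < r)
    (hsep : ∀ (k k' : Fin 28) (z z' : ℤ), (k ≠ k' ∨ z ≠ z') →
      r ≤ |((z : ℝ) - phiForm δ k) / h28 a k - ((z' : ℝ) - phiForm δ k') / h28 a k'|)
    {ρb : ℝ} (hρ : ∀ k, |phiForm δ k / h28 a k| ≤ ρb) (hc1 : (2 * ρb + r / 2) * xMax a < 1)
    (hc2 : (2 * ρb + r / 2) * xMax a < wallDist a T)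
    (k : Fin 28) {z : ℤ} (hz0 : 0 ≤ z) (hzT : (z : ℝ) / h28 a k ≤ T) :
    torusN ((((z : ℝ) - phiForm δ k) / h28 a k - r / 2) • sParam a + δ) =
      patternN a ((z : ℝ) / h28 a k)
        (Finset.univ.filter fun l => phiForm δ k / h28 a k < phiForm δ l / h28 a l) := by
  classical
  have hb : (z : ℝ) / h28 a k ∈ bkpts a T := div_mem_bkpts (hpos k) hz0 hzT
  have e : (((z : ℝ) - phiForm δ k) / h28 a k - r / 2) • sParam a + δ =
      ((z : ℝ) / h28 a k) • sParam a + ((-(phiForm δ k / h28 a k + r / 2)) • sParam a + δ) := by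
    rw [sub_div, sub_smul, sub_smul, neg_add, add_smul, neg_smul, neg_smul]; abel
  have hφ : ∀ l, phiForm ((-(phiForm δ k / h28 a k + r / 2)) • sParam a + δ) l =
      h28 a l * (phiForm δ l / h28 a l - phiForm δ k / h28 a k - r / 2) := fun l => by
    rw [phiForm_line]; field_simp [(hpos l).ne']; ring
  have hbd : ∀ l, |phiForm ((-(phiForm δ k / h28 a k + r / 2)) • sParam a + δ) l| ≤ (2 * ρb + r / 2) * xMax a :=
    fun l => by
    rw [hφ l, abs_mul, abs_of_pos (hpos l)]
    have h1 := abs_sub (phiForm δ l / h28 a l - phiForm δ k / h28 a k) (r / 2)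
    have h1' := abs_sub (phiForm δ l / h28 a l) (phiForm δ k / h28 a k)
    have h2 := hρ l
    have h3 := hρ k
    have h4 := le_xMax a l
    rw [abs_of_pos (by positivity : (0 : ℝ) < r / 2)] at h1
    have h5 : |phiForm δ l / h28 a l - phiForm δ k / h28 a k - r / 2| ≤ 2 * ρb + r / 2 := by linarith
    calc h28 a l * |phiForm δ l / h28 a l - phiForm δ k / h28 a k - r / 2| ≤ xMax a * (2 * ρb + r / 2) :=
          mul_le_mul h4 h5 (abs_nonneg _) ((hpos l).le.trans h4)
      _ = (2 * ρb + r / 2) * xMax a := by ring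
  rw [e, torusN_bkpt_add_eq_patternN hb (fun l => (hbd l).trans_lt hc1) (fun l => (hbd l).trans_lt hc2)
    (M := Finset.univ) (fun l _ => Finset.mem_univ l)]
  refine patternN_congr fun l hl => ?_
  simp only [Finset.mem_filter, Finset.mem_univ, true_and]
  rw [hφ l, mul_nonneg_iff_of_pos_left (hpos l)]
  obtain ⟨zl, hzl⟩ := hl
  by_cases hlk : l = k
  · subst hlk
    constructor
    · intro h; linarith
    · intro h; exact absurd h (lt_irrefl _)
  · -- the member `l` crosses at `b − ρ_l`; the margin separates it from `k`'s crossing at `b − ρ_k`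
    have hs := hsep k l z zl (Or.inl (Ne.symm hlk))
    have ezl : ((zl : ℝ) - phiForm δ l) / h28 a l = (z : ℝ) / h28 a k - phiForm δ l / h28 a l := by
      rw [← hzl]; field_simp [(hpos l).ne']
    rw [ezl, sub_div, show (z : ℝ) / h28 a k - phiForm δ k / h28 a k - ((z : ℝ) / h28 a k - phiForm δ l / h28 a l) =
      phiForm δ l / h28 a l - phiForm δ k / h28 a k by ring] at hs
    constructor
    · intro h; linarith
    · intro h
      rw [abs_of_pos (by linarith)] at hs
      linarith

/-- **THE JUMP IS THE CANONICAL MARGINAL OF ITS JUNCTION**: under the hypotheses of the two lemmas above,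
`J_{k,z} = 𝒩(θ_{s_{k,z}}) − 𝒩(θ_{s_{k,z} − r/2}) = patternN a (z/h_k) (P≤(k)) − patternN a (z/h_k) (P<(k))`. -/
theorem jump_eq_patternN_marginal {a : Dir} (hpos : ∀ k, 0 < h28 a k) {T : ℝ} {δ : Fin 8 → ℝ} {r : ℝ}
    (hr : 0 < r)
    (hsep : ∀ (k k' : Fin 28) (z z' : ℤ), (k ≠ k' ∨ z ≠ z') →
      r ≤ |((z : ℝ) - phiForm δ k) / h28 a k - ((z' : ℝ) - phiForm δ k') / h28 a k'|)
    {ρb : ℝ} (hρ : ∀ k, |phiForm δ k / h28 a k| ≤ ρb) (hc1 : (2 * ρb + r / 2) * xMax a < 1)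
    (hc2 : (2 * ρb + r / 2) * xMax a < wallDist a T)
    (k : Fin 28) {z : ℤ} (hz0 : 0 ≤ z) (hzT : (z : ℝ) / h28 a k ≤ T) :
    torusN ((((z : ℝ) - phiForm δ k) / h28 a k) • sParam a + δ) -
        torusN ((((z : ℝ) - phiForm δ k) / h28 a k - r / 2) • sParam a + δ) =
      patternN a ((z : ℝ) / h28 a k)
          (Finset.univ.filter fun l => phiForm δ k / h28 a k ≤ phiForm δ l / h28 a l) -
        patternN a ((z : ℝ) / h28 a k)
          (Finset.univ.filter fun l => phiForm δ k / h28 a k < phiForm δ l / h28 a l) := by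
  have hx : 0 < xMax a := xMax_pos hpos
  have hc1' : 2 * ρb * xMax a < 1 := by nlinarith
  have hc2' : 2 * ρb * xMax a < wallDist a T := by nlinarith
  rw [torusN_at_crossing_eq_patternN hpos hρ hc1' hc2' k hz0 hzT,
    torusN_before_crossing_eq_patternN hpos hr hsep hρ hc1 hc2 k hz0 hzT]

/-! ### Bookkeeping: junction sums versus crossing sums -/

open scoped Classical in
/-- A junction sum whose non-member terms vanish is the sum over the member junctions of `k`. -/
theorem sum_range_bkpt_eq_sum_filter_member {a : Dir} {T : ℝ} (k : Fin 28) {g : ℝ → ℝ}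
    (hg : ∀ m, m < (bkpts a T).card - 1 → (∀ z : ℤ, bkpt a T m * h28 a k ≠ z) → g (bkpt a T m) = 0) :
    ∑ m ∈ Finset.range ((bkpts a T).card - 1), g (bkpt a T m) =
      ∑ m ∈ (Finset.range ((bkpts a T).card - 1)).filter (fun m => ∃ z : ℤ, bkpt a T m * h28 a k = z),
        g (bkpt a T m) := by
  rw [Finset.sum_filter]
  refine Finset.sum_congr rfl fun m hm => ?_
  split_ifs with h
  · rfl
  · push Not at h
    exact hg m (Finset.mem_range.mp hm) h

open scoped Classical in
/-- **The member junctions of `k` in `[0, T)` are the points `z/h_k(a)`, `0 ≤ z < N_k = T·h_k(a)`** (as an image finset;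
cf. P2 g30's `card_member_junctions`). -/
theorem image_member_junctions_eq {a : Dir} (hpos : ∀ k, 0 < h28 a k) {T : ℝ} (hT : 0 < T) (k : Fin 28) {N : ℤ}
    (hN : T * h28 a k = N) :
    ((Finset.range ((bkpts a T).card - 1)).filter (fun m => ∃ z : ℤ, bkpt a T m * h28 a k = z)).image (bkpt a T) =
      (Finset.Ico (0 : ℤ) N).image fun z : ℤ => (z : ℝ) / h28 a k := by
  have hk := hpos k
  have hcard := two_le_card_bkpts a hT
  ext x
  simp only [Finset.mem_image, Finset.mem_filter, Finset.mem_range, Finset.mem_Ico]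
  constructor
  · rintro ⟨m, ⟨hm, w, hw⟩, rfl⟩
    have hb0 : 0 ≤ bkpt a T m := (mem_bkpts_bounds (bkpt_mem (by omega))).1
    have hbT : bkpt a T m < T := by
      have h := bkpt_strictMono (a := a) (T := T) (m := m) (m' := (bkpts a T).card - 1) (by omega) (by omega)
      rwa [bkpt_last a hT] at h
    have hw0 : 0 ≤ w := by
      have : (0 : ℝ) ≤ w := by rw [← hw]; exact mul_nonneg hb0 hk.le
      exact_mod_cast this
    have hwn : w < N := by
      have : (w : ℝ) < N := by rw [← hw, ← hN]; exact mul_lt_mul_of_pos_right hbT hk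
      exact_mod_cast this
    exact ⟨w, ⟨hw0, hwn⟩, by rw [← hw, mul_div_cancel_right₀ _ hk.ne']⟩
  · rintro ⟨j, ⟨hj0, hjN⟩, rfl⟩
    have hjT : (j : ℝ) / h28 a k < T := by
      rw [div_lt_iff₀ hk, hN]; exact_mod_cast hjN
    have hmem : (j : ℝ) / h28 a k ∈ bkpts a T := div_mem_bkpts hk hj0 hjT.le
    obtain ⟨m, hm, hmx⟩ := exists_index_of_mem_bkpts hmem
    refine ⟨m, ⟨?_, j, ?_⟩, hmx⟩
    · by_contra hge
      have hm' : m = (bkpts a T).card - 1 := by omega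
      rw [hm', bkpt_last a hT] at hmx
      linarith
    · rw [hmx, div_mul_cancel₀ _ hk.ne']

open scoped Classical in
/-- **A member-junction sum of `k` is a sum over `0 ≤ z < N_k` of the values at `z/h_k(a)`.** -/
theorem sum_member_junctions_eq_sum_Ico {a : Dir} (hpos : ∀ k, 0 < h28 a k) {T : ℝ} (hT : 0 < T) (k : Fin 28)
    {N : ℤ} (hN : T * h28 a k = N) (g : ℝ → ℝ) :
    ∑ m ∈ (Finset.range ((bkpts a T).card - 1)).filter (fun m => ∃ z : ℤ, bkpt a T m * h28 a k = z),
        g (bkpt a T m) = ∑ z ∈ Finset.Ico (0 : ℤ) N, g ((z : ℝ) / h28 a k) := by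
  have hk := hpos k
  have hcard := two_le_card_bkpts a hT
  have hinj : ∀ m ∈ (Finset.range ((bkpts a T).card - 1)).filter (fun m => ∃ z : ℤ, bkpt a T m * h28 a k = z),
      ∀ m' ∈ (Finset.range ((bkpts a T).card - 1)).filter (fun m => ∃ z : ℤ, bkpt a T m * h28 a k = z),
        bkpt a T m = bkpt a T m' → m = m' := by
    intro m hm m' hm' h
    simp only [Finset.mem_filter, Finset.mem_range] at hm hm'
    by_contra hne
    rcases lt_or_gt_of_ne hne with hlt | hlt
    · exact absurd h (bkpt_strictMono hlt (by omega)).ne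
    · exact absurd h.symm (bkpt_strictMono hlt (by omega)).ne
  have hinj' : ∀ j ∈ Finset.Ico (0 : ℤ) N, ∀ j' ∈ Finset.Ico (0 : ℤ) N,
      (j : ℝ) / h28 a k = (j' : ℝ) / h28 a k → j = j' := by
    intro j _ j' _ h
    have : (j : ℝ) = j' := by
      have := congrArg (· * h28 a k) h
      simpa only [div_mul_cancel₀ _ hk.ne'] using this
    exact_mod_cast this
  rw [← Finset.sum_image (g := bkpt a T) (f := g) hinj, image_member_junctions_eq hpos hT k hN,
    Finset.sum_image hinj']

/-- **The crossing window versus the standard window.** For `|c| < 1`, `c ≠ 0`, `0 ≤ N` and `g(N) = g(0)`: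
`Σ_{z ∈ (⌊c⌋, ⌊c⌋ + N]} g(z) = Σ_{z ∈ [0, N)} g(z)` (`⌊c⌋ = 0`: the windows `(0, N]` and `[0, N)` differ by the endpoints,
which carry equal values; `⌊c⌋ = −1`: the windows coincide). -/
theorem sum_Ioc_floor_eq_sum_Ico {c : ℝ} (hc1 : |c| < 1) (hc0 : c ≠ 0) {N : ℤ} (hN : 0 ≤ N) (g : ℤ → ℝ)
    (hg : g N = g 0) :
    ∑ z ∈ Finset.Ioc ⌊c⌋ (⌊c⌋ + N), g z = ∑ z ∈ Finset.Ico 0 N, g z := by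
  obtain ⟨hc1a, hc1b⟩ := abs_lt.mp hc1
  rcases lt_or_gt_of_ne hc0 with hneg | hpos
  · have hf : ⌊c⌋ = -1 := by
      rw [Int.floor_eq_iff]; push_cast; constructor <;> linarith
    rw [hf]
    congr 1
    ext z
    simp only [Finset.mem_Ioc, Finset.mem_Ico]
    omega
  · have hf : ⌊c⌋ = 0 := by
      rw [Int.floor_eq_iff]; push_cast; constructor <;> linarith
    rw [hf, zero_add]
    have h1 : ∑ z ∈ Finset.Icc (0 : ℤ) N, g z = g 0 + ∑ z ∈ Finset.Ioc (0 : ℤ) N, g z := by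
      rw [← Finset.Ioc_insert_left hN, Finset.sum_insert (by simp)]
    have h2 : ∑ z ∈ Finset.Icc (0 : ℤ) N, g z = g N + ∑ z ∈ Finset.Ico (0 : ℤ) N, g z := by
      rw [← Finset.Ico_insert_right hN, Finset.sum_insert (by simp)]
    linarith

end Summit.KontsevichZagierPeriods.Zeta5Search.Barrier.ConeGamma

end
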